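import Literature.Analysis.OperatorTheory.ProjectionLowerBound
import HarnessLib

/-!
# Projection-error eigenvalue certificate: closing glue for guaranteed LOWER eigenvalue bounds (Liu's framework)

Topic `Literature/Computation/Certificates`; companion of
`Literature/Analysis/OperatorTheory/ProjectionLowerBound.lean`, where the MECHANISM is proved
(`liu_count_bound`, `liu_count_bound_of_le`, …: X. Liu, *A framework of verified eigenvalue bounds for
self-adjoint differential operators*, Appl. Math. Comput. 267 (2015) 341–355 [Liu2015], Thm 2.1 p. 3:
with the `M`-orthogonal projection `P_h : V(h) → V_h` ((4)) and the error constant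
`‖u − P_h u‖_N ≤ C_h ‖u − P_h u‖_M` ((5)) one has `λ_{h,k}/(1 + λ_{h,k} C_h²) ≤ λ_k` ((6)); the tree proves
the COUNTING form a validated computation uses: discrete coercivity at level `s` past `m` linear
constraints forces `s ≤ Λ(1 + C² s)` for every exact `b`-orthonormal `a`-diagonal family of more than `m`
vectors with levels `≤ Λ`).

This file types what sits BETWEEN a finite-element certificate record and those hypotheses — the three
steps a certificate-producing adapter (exact pencil assembly + certified matrix inertia + the constant
`C_h` quoted from print) performs in exact rational arithmetic and that a reader re-decides:

* **A. Assembly** ([Liu2015] §3.1 p. 5, eq. (13): the interpolation is `M_h`-orthogonal ELEMENT BY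
  ELEMENT, summed to the global orthogonality; eq. (14) and the sentence «Thus `C_h` can be taken as
  `C_h := max_{K ∈ K_h} C(K, ℝ^m)`»): for forms that are finite sums `a = Σ_t a_t`, `b = Σ_t b_t` of
  elementwise forms, elementwise orthogonality of the projection gives `horth`, and elementwise constants
  `b_t(ψ,ψ) ≤ C_t² a_t(ψ,ψ)` give `happrox` with any `C² ≥ max_t C_t²` (`projOrth_of_local`,
  `approx_of_local`); with FROZEN ELEMENTWISE WEIGHTS `a' = Σ w_t å_t`, `b' = Σ ω_t b̊_t` (`w_t > 0`,
  `ω_t ≥ 0`; the comparison forms of `liu_count_bound_of_le` for a weighted operator such as `−Δ*` with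
  weight `1/R`) the unweighted local constants `c_t` transfer with `C² ≥ max_t (ω_t / w_t) c_t²`
  (`projOrth_of_weighted_local`, `approx_of_weighted_local`).
* **B. Matrix legs** (real symmetric matrices `K, M` = Gram matrices of `a', b'` on the discrete basis;
  `hcoer_of_matrices` of the companion file turns constrained nonnegativity of `K − sM` into `hcoer`):
  CUT MONOTONICITY (`constrained_nonneg_mono`: nonnegative past the constraints at level `s` and `M ⪰ 0`
  ⇒ at every `s' ≤ s`), and the WEYL-SLACK TRANSFER (`constrained_nonneg_of_slack`: if a floating-point
  kernel certifies only `yᵀ(K − sM + τ·1)y ≥ 0` past the constraints — a smallest-eigenvalue lower bound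
  `−τ` or an inertia count with slack `τ` of the SHIFTED STANDARD matrix — and `yᵀ M y ≥ μ yᵀy` with
  `μ > 0`, then `K − (s − τ/μ)M` is nonnegative past the same constraints), with `μ` read off a diagonal
  mass matrix (`mu_dotProduct_le_diagonal_mulVec`, the Crouzeix–Raviart mass matrix is diagonal) or off a
  positive-semidefiniteness certificate of `M − μ·1` (`mu_dotProduct_le_of_posSemidef_sub`).
* **C. The record** `ProjectionLowerCert ⟨s, c2, lo⟩` over `ℚ` — `s` the certified coercivity level (cut,
  after B), `c2` an UPPER bound of `C²`, `lo` the claimed lower bound — with the kernel-decidable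
  `check = (0 < s ∧ 0 < c2 ∧ lo·(1 + c2·s) ≤ s)`, `check_eq_true_iff` (a client row closes by
  `rw [check_eq_true_iff]; norm_num` or `decide +kernel`), the ENDPOINT RULE `check_mono` (a smaller `lo`,
  a smaller positive `c2`, a larger `s` still pass), and SOUNDNESS: `sound` (`check` ∧ the hypotheses of
  `liu_count_bound_of_le` at level `s` with any real constant `C2 ≤ c2` ⇒ `lo ≤ Λ` for every
  `b`-orthonormal `a`-diagonal family of `k > m` vectors with levels `≤ Λ`) and `sound_card` (for every such
  family of any size, at most `m` members have level `< lo` — i.e. `λ_{m+1} ≥ lo` once the client's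
  spectral theorem lists the exact eigenpairs in increasing order).

RECORD ↦ BINDERS (record shape of the cell's elliptic-eigenvalue adapter note ELLIPTIC-EIG-SPEC, legs
L2/L3/L5): cut `s` (dyadic) ↦ `s`; «constant + locator» `C_h` ↦ `c2 ≥ C_h²` (for Crouzeix–Raviart with
frozen weights: `c2 = max_T (ω_T/w_T)(0.1893 h_T)²`); per-`k` «count cert» ↦ `m` and the constraint
functionals `ℓ`/`q` (exact inertia: `SchurComplementCount.exists_constraints_nonneg_of_inertia_le`;
pinned Schur split: `fromBlocks_dotProduct_nonneg_of_schur`); «lower» ↦ `lo`. The UPPER side of such a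
record (Rayleigh–Ritz with an exact `k × k` projected pencil, `μ M̂ − K̂ ≻ 0`) needs no new statement:
`LehmannGoerisch.rr_hypothesis_of_matrices` + `rayleigh_ritz_count`.

HYPOTHESES A CLIENT MUST READ (binders here, never discharged in this file): `a' ≤ a`, `b ≤ b'` for the
comparison pair actually assembled; the exact eigenfamily is `b`-orthonormal and `a`-diagonal (for a PDE
the spectral theorem / compact embedding, [Liu2015] (A1)–(A2), is the CLIENT's input — this file is
operator-free linear algebra, as its companion); the projection is `a'`-orthogonal on the relevant span
with error constant `C² ≤ c2` — for finite elements THE VALUE OF `C_h` IS A PRINTED THEOREM ABOUT THE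
ELEMENT, NOT CERTIFIED HERE: Crouzeix–Raviart `C(K) ≤ 0.1893 h_K` for every triangle ([Liu2015] §4 p. 9,
computer-assisted; analytic `0.2983` Carstensen–Gedicke, `0.346` [Liu2015] Thm 3.2), conforming `P1` via
Liu–Oishi (SIAM J. Numer. Anal. 51 (2013) Thm 3.1 / 3.3, the latter with a computed `κ_h`); domain
inclusions for curved domains; the arithmetic model of any floating-point leg that produced `τ`.
WHAT THIS IS NOT: not a finite-element library (no meshes / Sobolev spaces in the tree: `C_h` enters as
the rational field `c2`, its locator carried by the record); not an eigenvalue EXISTENCE statement; not a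
statement about any client's numbers. Everything here is PROVED (standard axioms); no named facts. -/

namespace Literature.Computation.Certificates

open scoped BigOperators
open Finset
/-! ## A. Assembly: elementwise projection data ⇒ the global hypotheses `horth` / `happrox` -/
section Assembly

variable {V : Type*} [AddCommGroup V] [Module ℝ V] {ι : Type*} [Fintype ι]

/-- Evaluation of a finite sum of bilinear forms: `(Σ_t f_t)(x, y) = Σ_t f_t(x, y)`. [folklore] -/
private theorem bilinForm_sum_apply (f : ι → LinearMap.BilinForm ℝ V) (x y : V) :
    (∑ t, f t) x y = ∑ t, f t x y := by
  rw [LinearMap.sum_apply, LinearMap.sum_apply]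

/-- **Elementwise orthogonality sums to global orthogonality** ([Liu2015] §3.1 eq. (13): on each element
`∫_K ∇(P_h u − u)·∇v_h = 0`, hence `M_h(P_h u − u, v_h) = Σ_K … = 0`). Abstract form: if every elementwise
form `a_t` annihilates `(Πφ, φ − Πφ)` then so does `a = Σ_t a_t` — hypothesis `horth` of
`ProjectionLowerBound.liu_count_bound(_of_le)`. [cite: Liu2015, §3.1 eq. (13) p. 5] -/
theorem projOrth_of_local (aT : ι → LinearMap.BilinForm ℝ V) (proj : V →ₗ[ℝ] V) (φ : V)
    (h : ∀ t, aT t (proj φ) (φ - proj φ) = 0) :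
    (∑ t, aT t) (proj φ) (φ - proj φ) = 0 := by
  rw [bilinForm_sum_apply]
  exact Finset.sum_eq_zero fun t _ => h t

/-- **Elementwise orthogonality with frozen elementwise weights**: if every unweighted elementwise form
`å_t` annihilates `(Πφ, φ − Πφ)`, so does the weighted sum `a' = Σ_t w_t å_t` (constant weight per
element). [cite: Liu2015, §3.1 eq. (13) p. 5 (weighted-sum reading)] -/
theorem projOrth_of_weighted_local (a0 : ι → LinearMap.BilinForm ℝ V) (w : ι → ℝ) (proj : V →ₗ[ℝ] V)
    (φ : V) (h : ∀ t, a0 t (proj φ) (φ - proj φ) = 0) :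
    (∑ t, w t • a0 t) (proj φ) (φ - proj φ) = 0 := by
  rw [bilinForm_sum_apply]
  refine Finset.sum_eq_zero fun t _ => ?_
  rw [LinearMap.smul_apply, LinearMap.smul_apply, h t, smul_zero]

/-- **Local error constants give the global one** ([Liu2015] §3.1 eq. (14) and «Thus `C_h` can be taken
as `C_h := max_{K∈K_h} C(K, ℝ^m)`»). Abstract form: for `a = Σ_t a_t` with `a_t ⪰ 0` and `b = Σ_t b_t`,
elementwise `b_t(ψ,ψ) ≤ C_t² a_t(ψ,ψ)` with `C_t² ≤ C2` for all `t` gives `b(ψ,ψ) ≤ C2 · a(ψ,ψ)` —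
hypothesis `happrox` at `ψ = φ − Πφ`. [cite: Liu2015, §3.1 eq. (14) p. 5] -/
theorem approx_of_local (aT bT : ι → LinearMap.BilinForm ℝ V) (CT : ι → ℝ) {C2 : ℝ}
    (ha_nonneg : ∀ t x, 0 ≤ aT t x x) (hCT : ∀ t, CT t ^ 2 ≤ C2)
    (ψ : V) (hloc : ∀ t, bT t ψ ψ ≤ CT t ^ 2 * aT t ψ ψ) :
    (∑ t, bT t) ψ ψ ≤ C2 * (∑ t, aT t) ψ ψ := by
  rw [bilinForm_sum_apply, bilinForm_sum_apply, Finset.mul_sum]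
  exact Finset.sum_le_sum fun t _ =>
    (hloc t).trans (mul_le_mul_of_nonneg_right (hCT t) (ha_nonneg t ψ))

/-- **Local constants with frozen elementwise weights.** For `a' = Σ_t w_t å_t` (`w_t > 0`, `å_t ⪰ 0`)
and `b' = Σ_t ω_t b̊_t` (`ω_t ≥ 0`) with UNWEIGHTED elementwise constants `b̊_t(ψ,ψ) ≤ c_t² å_t(ψ,ψ)`
(e.g. the Crouzeix–Raviart interpolation constant `c_t = 0.1893 h_t` of [Liu2015] §4), any
`C2 ≥ max_t (ω_t / w_t) c_t²` gives `b'(ψ,ψ) ≤ C2 · a'(ψ,ψ)`. This is the constant a weighted-operator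
(`−Δ*`, weight `1/R` frozen per element from below in `a'` and from above in `b'`) certificate records.
[cite: Liu2015, §3.1 eq. (14) p. 5 (weighted-sum reading)] -/
theorem approx_of_weighted_local (a0 b0 : ι → LinearMap.BilinForm ℝ V) (w ω c : ι → ℝ) {C2 : ℝ}
    (ha_nonneg : ∀ t x, 0 ≤ a0 t x x) (hw : ∀ t, 0 < w t) (hω : ∀ t, 0 ≤ ω t)
    (hC : ∀ t, ω t / w t * c t ^ 2 ≤ C2)
    (ψ : V) (hloc : ∀ t, b0 t ψ ψ ≤ c t ^ 2 * a0 t ψ ψ) :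
    (∑ t, ω t • b0 t) ψ ψ ≤ C2 * (∑ t, w t • a0 t) ψ ψ := by
  rw [bilinForm_sum_apply, bilinForm_sum_apply, Finset.mul_sum]
  refine Finset.sum_le_sum fun t _ => ?_
  simp only [LinearMap.smul_apply, smul_eq_mul]
  have hw0 : w t ≠ 0 := (hw t).ne'
  have h1 : ω t * b0 t ψ ψ ≤ ω t * (c t ^ 2 * a0 t ψ ψ) := mul_le_mul_of_nonneg_left (hloc t) (hω t)
  have h2 : ω t * (c t ^ 2 * a0 t ψ ψ) = (ω t / w t * c t ^ 2) * (w t * a0 t ψ ψ) := by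
    field_simp
  have h3 : (ω t / w t * c t ^ 2) * (w t * a0 t ψ ψ) ≤ C2 * (w t * a0 t ψ ψ) :=
    mul_le_mul_of_nonneg_right (hC t) (mul_nonneg (hw t).le (ha_nonneg t ψ))
  calc ω t * b0 t ψ ψ ≤ ω t * (c t ^ 2 * a0 t ψ ψ) := h1
    _ = (ω t / w t * c t ^ 2) * (w t * a0 t ψ ψ) := h2
    _ ≤ C2 * (w t * a0 t ψ ψ) := h3

end Assembly

/-! ## B. Matrix legs: cut monotonicity and the Weyl-slack transfer to the pencil -/
section MatrixLegs
open Matrix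
variable {n : Type*} [Fintype n]

/-- **Cut monotonicity.** If `yᵀ(K − sM)y ≥ 0` for every `y` annihilated by the constraint vectors `q_j`
and `M ⪰ 0` as a quadratic form, then `yᵀ(K − s'M)y ≥ 0` under the same constraints for every `s' ≤ s`:
a certified coercivity level may always be lowered (the cut actually certified by a kernel is below the
dyadic proposal) — the monotonicity principle `λ_i(A) ≤ λ_i(A + B)`, `B ⪰ 0`, read as the quadratic-form
inequality `K − s'M = (K − sM) + (s − s')M ⪰ K − sM` on the constraint subspace.
[cite: HornJohnson2013, Cor. 4.3.12 (4.3.13) (monotonicity principle, quadratic-form reading on a subspace)] -/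
theorem constrained_nonneg_mono {k : ℕ} (K M : Matrix n n ℝ) (q : Fin k → n → ℝ) {s s' : ℝ}
    (hss : s' ≤ s) (hM : ∀ y : n → ℝ, 0 ≤ y ⬝ᵥ (M *ᵥ y))
    (hpos : ∀ y : n → ℝ, (∀ j, q j ⬝ᵥ y = 0) → 0 ≤ y ⬝ᵥ ((K - s • M) *ᵥ y))
    (y : n → ℝ) (hy : ∀ j, q j ⬝ᵥ y = 0) : 0 ≤ y ⬝ᵥ ((K - s' • M) *ᵥ y) := by
  have h := hpos y hy
  have hm := hM y
  rw [Matrix.sub_mulVec, Matrix.smul_mulVec, dotProduct_sub, dotProduct_smul, smul_eq_mul] at h ⊢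
  have h2 : s' * (y ⬝ᵥ (M *ᵥ y)) ≤ s * (y ⬝ᵥ (M *ᵥ y)) := mul_le_mul_of_nonneg_right hss hm
  linarith

/-- **Weyl-slack transfer to the pencil.** If `yᵀ(K − sM + τ·1)y ≥ 0` for every `y` annihilated by the
constraints (what a floating-point kernel certifies about the SHIFTED STANDARD matrix `K − sM`: a
smallest-eigenvalue lower bound `−τ`, or an inertia count with slack `τ ≥ 0`), and the mass form dominates
`μ·(yᵀy)` with `μ > 0`, then `yᵀ(K − (s − τ/μ)M)y ≥ 0` under the same constraints: the coercivity LEVEL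
drops by `τ/μ` and the pencil statement `hcoer_of_matrices` needs is recovered — the monotonicity
principle applied to `K − (s − τ/μ)M = (K − sM + τ·1) + (τ/μ)(M − μ·1)` with `(τ/μ)(M − μ·1) ⪰ 0`.
[cite: HornJohnson2013, Cor. 4.3.12 (4.3.13) (monotonicity principle, quadratic-form reading on a subspace)] -/
theorem constrained_nonneg_of_slack [DecidableEq n] {k : ℕ} (K M : Matrix n n ℝ) (q : Fin k → n → ℝ) {s τ μ : ℝ}
    (hμ : 0 < μ) (hτ : 0 ≤ τ)
    (hM : ∀ y : n → ℝ, μ * (y ⬝ᵥ y) ≤ y ⬝ᵥ (M *ᵥ y))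
    (hslack : ∀ y : n → ℝ, (∀ j, q j ⬝ᵥ y = 0) →
      0 ≤ y ⬝ᵥ ((K - s • M + τ • (1 : Matrix n n ℝ)) *ᵥ y))
    (y : n → ℝ) (hy : ∀ j, q j ⬝ᵥ y = 0) : 0 ≤ y ⬝ᵥ ((K - (s - τ / μ) • M) *ᵥ y) := by
  have h := hslack y hy
  have hm := hM y
  rw [Matrix.add_mulVec, Matrix.sub_mulVec, Matrix.smul_mulVec, Matrix.smul_mulVec, Matrix.one_mulVec,
    dotProduct_add, dotProduct_sub, dotProduct_smul, dotProduct_smul, smul_eq_mul, smul_eq_mul] at h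
  rw [Matrix.sub_mulVec, Matrix.smul_mulVec, dotProduct_sub, dotProduct_smul, smul_eq_mul]
  have hkey : τ * (y ⬝ᵥ y) ≤ τ / μ * (y ⬝ᵥ (M *ᵥ y)) := by
    have h1 : τ / μ * (μ * (y ⬝ᵥ y)) ≤ τ / μ * (y ⬝ᵥ (M *ᵥ y)) :=
      mul_le_mul_of_nonneg_left hm (div_nonneg hτ hμ.le)
    have e : τ / μ * (μ * (y ⬝ᵥ y)) = τ * (y ⬝ᵥ y) := by
      rw [← mul_assoc, div_mul_cancel₀ τ hμ.ne']
    linarith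
  have e2 : (s - τ / μ) * (y ⬝ᵥ (M *ᵥ y)) = s * (y ⬝ᵥ (M *ᵥ y)) - τ / μ * (y ⬝ᵥ (M *ᵥ y)) := by ring
  linarith

/-- The same transfer with the slack stated as `yᵀ(K − sM)y ≥ −τ·yᵀy` under the constraints.
[cite: HornJohnson2013, Cor. 4.3.12 (4.3.13) (monotonicity principle, quadratic-form reading; slack form)] -/
theorem constrained_nonneg_of_slack' [DecidableEq n] {k : ℕ} (K M : Matrix n n ℝ) (q : Fin k → n → ℝ) {s τ μ : ℝ}
    (hμ : 0 < μ) (hτ : 0 ≤ τ)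
    (hM : ∀ y : n → ℝ, μ * (y ⬝ᵥ y) ≤ y ⬝ᵥ (M *ᵥ y))
    (hslack : ∀ y : n → ℝ, (∀ j, q j ⬝ᵥ y = 0) → -(τ * (y ⬝ᵥ y)) ≤ y ⬝ᵥ ((K - s • M) *ᵥ y))
    (y : n → ℝ) (hy : ∀ j, q j ⬝ᵥ y = 0) : 0 ≤ y ⬝ᵥ ((K - (s - τ / μ) • M) *ᵥ y) := by
  refine constrained_nonneg_of_slack K M q hμ hτ hM (fun z hz => ?_) y hy
  have h := hslack z hz
  rw [Matrix.add_mulVec, dotProduct_add, Matrix.smul_mulVec, Matrix.one_mulVec, dotProduct_smul,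
    smul_eq_mul]
  linarith

/-- **Mass lower bound from a diagonal mass matrix** (Crouzeix–Raviart: the elementwise basis functions
are `L²`-orthogonal on each triangle, so the assembled mass matrix is diagonal): `M = diagonal d` with
`μ ≤ d_i` for all `i` gives `μ·(yᵀy) ≤ yᵀ M y` (Rayleigh quotient theorem, `λ_min x*x ≤ x*Ax`, for a
diagonal matrix whose least entry is `≥ μ`). [cite: HornJohnson2013, Thm 4.2.2 (c) (Rayleigh quotient theorem, diagonal case)] -/
theorem mu_dotProduct_le_diagonal_mulVec [DecidableEq n] (d : n → ℝ) {μ : ℝ} (hd : ∀ i, μ ≤ d i) (y : n → ℝ) :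
    μ * (y ⬝ᵥ y) ≤ y ⬝ᵥ (Matrix.diagonal d *ᵥ y) := by
  simp only [dotProduct, Matrix.mulVec_diagonal, Finset.mul_sum]
  refine Finset.sum_le_sum fun i _ => ?_
  have h := mul_le_mul_of_nonneg_right (hd i) (mul_self_nonneg (y i))
  linarith

/-- **Mass lower bound from a positive-semidefiniteness certificate** of `M − μ·1` (exact `LDLᵀ` /
interval Cholesky): `μ·(yᵀy) ≤ yᵀ M y`, i.e. `M ⪰ μ·1` in the Loewner order read as a quadratic-form
inequality. [cite: HornJohnson2013, §7.7 (7.7.1) (Loewner order `M ⪰ μI` as `x*(M − μI)x ≥ 0`)] -/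
theorem mu_dotProduct_le_of_posSemidef_sub [DecidableEq n] (M : Matrix n n ℝ) {μ : ℝ}
    (h : (M - μ • (1 : Matrix n n ℝ)).PosSemidef) (y : n → ℝ) :
    μ * (y ⬝ᵥ y) ≤ y ⬝ᵥ (M *ᵥ y) := by
  have h2 := (posSemidef_iff_dotProduct_mulVec.mp h).2 y
  rw [star_trivial, Matrix.sub_mulVec, Matrix.smul_mulVec, Matrix.one_mulVec, dotProduct_sub,
    dotProduct_smul, smul_eq_mul] at h2
  linarith

end MatrixLegs

/-! ## C. The record, its kernel-decidable check, the endpoint rule and soundness -/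

/-- The exact-rational closing record of a projection-error LOWER eigenvalue bound: `s` = the certified
discrete coercivity level (cut) past `m` constraints on the assembled comparison pencil (after the slack
transfer of part B), `c2` = an UPPER bound of the squared projection-error constant `C²` (for
Crouzeix–Raviart with frozen weights `max_T (ω_T/w_T)(0.1893 h_T)²`, quoted from print), `lo` = the
claimed lower bound of the `(m+1)`-st exact eigenvalue. [cite: Liu2015, Thm 2.1 eq. (6) p. 3 (data of the bound)] -/
structure ProjectionLowerCert where
  /-- the certified coercivity level `s > 0` (cut) of the discrete pencil past the constraints -/
  s : ℚ
  /-- an upper bound `c2 > 0` of `C²`, `C` the projection-error constant of (5) -/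
  c2 : ℚ
  /-- the claimed lower eigenvalue bound -/
  lo : ℚ

namespace ProjectionLowerCert

/-- The kernel-decidable closing check: `0 < s`, `0 < c2` and `lo·(1 + c2·s) ≤ s`, i.e.
`lo ≤ s/(1 + c2 s)` — [Liu2015] (6) with the division cleared. [cite: Liu2015, Thm 2.1 eq. (6) p. 3 (closing inequality)] -/
def check (c : ProjectionLowerCert) : Bool :=
  decide (0 < c.s) && decide (0 < c.c2) && decide (c.lo * (1 + c.c2 * c.s) ≤ c.s)

/-- `check` unfolded to its three rational inequalities (a client row closes by
`rw [check_eq_true_iff]; norm_num`). [cite: Liu2015, Thm 2.1 eq. (6) p. 3 (closing inequality, unfolded)] -/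
theorem check_eq_true_iff (c : ProjectionLowerCert) :
    c.check = true ↔ 0 < c.s ∧ 0 < c.c2 ∧ c.lo * (1 + c.c2 * c.s) ≤ c.s := by
  simp [check, Bool.and_eq_true, decide_eq_true_eq, and_assoc]

/-- **Endpoint rule.** A record with a smaller claimed bound `lo' ≤ lo`, a smaller (still positive)
constant bound `c2' ≤ c2` and a larger cut `s' ≥ s` passes whenever `⟨s, c2, lo⟩` passes — `s/(1 + c2 s)`
is non-decreasing in `s` and non-increasing in `c2`; so true quantities inside the certified rational
endpoints keep the check valid. [cite: Liu2015, Thm 2.1 eq. (6) p. 3 (monotonicity of the bound in λ_{h,k} and C_h)] -/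
theorem check_mono {c c' : ProjectionLowerCert} (h : c.check = true)
    (hlo : c'.lo ≤ c.lo) (hc2 : c'.c2 ≤ c.c2) (hc2' : 0 < c'.c2) (hs : c.s ≤ c'.s) :
    c'.check = true := by
  rw [check_eq_true_iff] at h ⊢
  obtain ⟨hs0, hc20, hmain⟩ := h
  have hs0' : 0 < c'.s := lt_of_lt_of_le hs0 hs
  refine ⟨hs0', hc2', ?_⟩
  rcases le_or_gt 0 c'.lo with hlo0 | hlo0
  · -- 0 ≤ lo' ≤ lo
    have hlo0c : 0 ≤ c.lo := hlo0.trans hlo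
    have hloc2 : c.lo * c.c2 ≤ 1 := by
      by_contra hgt
      push Not at hgt
      have h1 : 1 * c.s < c.lo * c.c2 * c.s := mul_lt_mul_of_pos_right hgt hs0
      nlinarith
    have step1 : c'.lo * (1 + c'.c2 * c'.s) ≤ c.lo * (1 + c.c2 * c'.s) := by
      apply mul_le_mul hlo _ _ hlo0c
      · nlinarith [hs0'.le, hc2]
      · nlinarith [hs0'.le, hc2'.le]
    have step2 : c.lo * (1 + c.c2 * c'.s) ≤ c'.s := by
      have h3 : (c'.s - c.s) * (c.lo * c.c2) ≤ (c'.s - c.s) * 1 :=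
        mul_le_mul_of_nonneg_left hloc2 (sub_nonneg.mpr hs)
      nlinarith
    exact step1.trans step2
  · -- lo' < 0: the left-hand side is negative
    have hden : 0 < 1 + c'.c2 * c'.s := by positivity
    have : c'.lo * (1 + c'.c2 * c'.s) < 0 := mul_neg_of_neg_of_pos hlo0 hden
    linarith

/-- **Soundness of the record (Λ-form).** If `⟨s, c2, lo⟩` passes `check` and the hypotheses of
`ProjectionLowerBound.liu_count_bound_of_le` hold at level `s` — comparison forms `a' ⪰ 0`, `b' ⪰ 0`
symmetric with `a' ≤ a`, `b ≤ b'`; an exact `b`-orthonormal, `a`-diagonal family `u` of `k > m` vectors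
with levels `λ_i ≤ Λ`; a projection that is `a'`-orthogonal on `span u` with error constant
`b'(φ−Πφ, φ−Πφ) ≤ C2·a'(φ−Πφ, φ−Πφ)` for some real `C2 ≤ c2`; discrete coercivity
`s·b'(Πφ,Πφ) ≤ a'(Πφ,Πφ)` on the part of `Π(span u)` annihilated by `m` functionals — then `lo ≤ Λ`.
[cite: Liu2015, Thm 2.1 eq. (6) p. 3 (certificate form)] -/
theorem sound (c : ProjectionLowerCert) (hc : c.check = true)
    {V : Type*} [AddCommGroup V] [Module ℝ V]
    (a b a' b' : LinearMap.BilinForm ℝ V)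
    (ha'_symm : ∀ x y, a' x y = a' y x) (hb'_symm : ∀ x y, b' x y = b' y x)
    (ha'_nonneg : ∀ x, 0 ≤ a' x x) (hb'_nonneg : ∀ x, 0 ≤ b' x x)
    (ha'_le : ∀ x, a' x x ≤ a x x) (hb_le : ∀ x, b x x ≤ b' x x)
    {k m : ℕ} (hmk : m < k) (u : Fin k → V) (lam : Fin k → ℝ) {Λ C2 : ℝ}
    (hb_on : ∀ i j, b (u i) (u j) = if i = j then 1 else 0)
    (ha_on : ∀ i j, a (u i) (u j) = if i = j then lam i else 0)
    (hlam : ∀ i, lam i ≤ Λ) (hC2 : C2 ≤ c.c2)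
    (proj : V →ₗ[ℝ] V) (ℓ : Fin m → V →ₗ[ℝ] ℝ)
    (horth : ∀ φ ∈ Submodule.span ℝ (Set.range u), a' (proj φ) (φ - proj φ) = 0)
    (happrox : ∀ φ ∈ Submodule.span ℝ (Set.range u),
      b' (φ - proj φ) (φ - proj φ) ≤ C2 * a' (φ - proj φ) (φ - proj φ))
    (hcoer : ∀ φ ∈ Submodule.span ℝ (Set.range u), (∀ j, ℓ j (proj φ) = 0) →
      (c.s : ℝ) * b' (proj φ) (proj φ) ≤ a' (proj φ) (proj φ)) :
    (c.lo : ℝ) ≤ Λ := by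
  obtain ⟨hs, hc2, hmain⟩ := (check_eq_true_iff c).mp hc
  have hc2R : (0 : ℝ) < c.c2 := by exact_mod_cast hc2
  have hsR : (0 : ℝ) < c.s := by exact_mod_cast hs
  set C : ℝ := Real.sqrt c.c2 with hCdef
  have hCpos : 0 < C := Real.sqrt_pos.mpr hc2R
  have hCsq : C ^ 2 = (c.c2 : ℝ) := Real.sq_sqrt hc2R.le
  have happrox' : ∀ φ ∈ Submodule.span ℝ (Set.range u),
      b' (φ - proj φ) (φ - proj φ) ≤ C ^ 2 * a' (φ - proj φ) (φ - proj φ) := fun φ hφ =>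
    (happrox φ hφ).trans (by rw [hCsq]; exact mul_le_mul_of_nonneg_right hC2 (ha'_nonneg _))
  have key := Literature.Analysis.OperatorTheory.liu_count_bound_of_le a b a' b' ha'_symm hb'_symm
    ha'_nonneg hb'_nonneg ha'_le hb_le hmk u lam hb_on ha_on hlam hCpos hsR proj ℓ horth happrox' hcoer
  rw [hCsq] at key
  have hmainR : (c.lo : ℝ) * (1 + (c.c2 : ℝ) * c.s) ≤ c.s := by exact_mod_cast hmain
  have hden : (0 : ℝ) < 1 + (c.c2 : ℝ) * c.s := by positivity
  by_contra hlt
  push Not at hlt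
  have h1 : Λ * (1 + (c.c2 : ℝ) * c.s) < (c.lo : ℝ) * (1 + (c.c2 : ℝ) * c.s) :=
    mul_lt_mul_of_pos_right hlt hden
  linarith

/-- **Soundness of the record (counting form).** Under the same hypotheses for an exact family `u` of ANY
size `k` (hypotheses on `span u`), at most `m` members of the family have level `< lo`; for the increasing
enumeration of the exact eigenvalues of a client's operator this reads `λ_{m+1} ≥ lo`.
[cite: Liu2015, Thm 2.1 eq. (6) p. 3 (counting form of the certificate)] -/
theorem sound_card (c : ProjectionLowerCert) (hc : c.check = true)
    {V : Type*} [AddCommGroup V] [Module ℝ V]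
    (a b a' b' : LinearMap.BilinForm ℝ V)
    (ha'_symm : ∀ x y, a' x y = a' y x) (hb'_symm : ∀ x y, b' x y = b' y x)
    (ha'_nonneg : ∀ x, 0 ≤ a' x x) (hb'_nonneg : ∀ x, 0 ≤ b' x x)
    (ha'_le : ∀ x, a' x x ≤ a x x) (hb_le : ∀ x, b x x ≤ b' x x)
    {k m : ℕ} (u : Fin k → V) (lam : Fin k → ℝ) {C2 : ℝ}
    (hb_on : ∀ i j, b (u i) (u j) = if i = j then 1 else 0)
    (ha_on : ∀ i j, a (u i) (u j) = if i = j then lam i else 0)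
    (hC2 : C2 ≤ c.c2)
    (proj : V →ₗ[ℝ] V) (ℓ : Fin m → V →ₗ[ℝ] ℝ)
    (horth : ∀ φ ∈ Submodule.span ℝ (Set.range u), a' (proj φ) (φ - proj φ) = 0)
    (happrox : ∀ φ ∈ Submodule.span ℝ (Set.range u),
      b' (φ - proj φ) (φ - proj φ) ≤ C2 * a' (φ - proj φ) (φ - proj φ))
    (hcoer : ∀ φ ∈ Submodule.span ℝ (Set.range u), (∀ j, ℓ j (proj φ) = 0) →
      (c.s : ℝ) * b' (proj φ) (proj φ) ≤ a' (proj φ) (proj φ)) :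
    Fintype.card {i : Fin k // lam i < (c.lo : ℝ)} ≤ m := by
  classical
  by_contra hlt
  push Not at hlt
  set k' := Fintype.card {i : Fin k // lam i < (c.lo : ℝ)} with hk'def
  let e : Fin k' ≃ {i : Fin k // lam i < (c.lo : ℝ)} := (Fintype.equivFin _).symm
  let u' : Fin k' → V := fun i => u (e i).1
  let lam' : Fin k' → ℝ := fun i => lam (e i).1
  have hk'pos : 0 < k' := lt_of_le_of_lt (Nat.zero_le m) hlt
  haveI : Nonempty (Fin k') := ⟨⟨0, hk'pos⟩⟩
  obtain ⟨i₀, -, hi₀⟩ := Finset.exists_max_image Finset.univ lam' Finset.univ_nonempty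
  have hlam' : ∀ i, lam' i ≤ lam' i₀ := fun i => hi₀ i (Finset.mem_univ i)
  have hΛlt : lam' i₀ < (c.lo : ℝ) := (e i₀).2
  have hinj : ∀ i j : Fin k', (e i).1 = (e j).1 ↔ i = j := fun i j =>
    ⟨fun h => e.injective (Subtype.ext h), fun h => by rw [h]⟩
  have hb_on' : ∀ i j, b (u' i) (u' j) = if i = j then 1 else 0 := by
    intro i j
    show b (u (e i).1) (u (e j).1) = _
    rw [hb_on]
    by_cases hij : i = j
    · rw [if_pos ((hinj i j).mpr hij), if_pos hij]
    · rw [if_neg (fun h => hij ((hinj i j).mp h)), if_neg hij]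
  have ha_on' : ∀ i j, a (u' i) (u' j) = if i = j then lam' i else 0 := by
    intro i j
    show a (u (e i).1) (u (e j).1) = _
    rw [ha_on]
    by_cases hij : i = j
    · rw [if_pos ((hinj i j).mpr hij), if_pos hij]
    · rw [if_neg (fun h => hij ((hinj i j).mp h)), if_neg hij]
  have hspan : Submodule.span ℝ (Set.range u') ≤ Submodule.span ℝ (Set.range u) :=
    Submodule.span_mono (by rintro _ ⟨i, rfl⟩; exact ⟨(e i).1, rfl⟩)
  have hsound := sound c hc a b a' b' ha'_symm hb'_symm ha'_nonneg hb'_nonneg ha'_le hb_le hlt u' lam'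
    hb_on' ha_on' hlam' hC2 proj ℓ (fun φ hφ => horth φ (hspan hφ))
    (fun φ hφ => happrox φ (hspan hφ)) (fun φ hφ => hcoer φ (hspan hφ))
  linarith

/-- A sample record: cut `s = 10`, `c2 = 1/100`, claimed `lo = 9` (`9·(1 + 10/100) = 9.9 ≤ 10`). [folklore] -/
example : (⟨10, 1 / 100, 9⟩ : ProjectionLowerCert).check = true := by
  rw [check_eq_true_iff]; norm_num

/-- A failing sample: same cut and constant, `lo = 91/10` (`(91/10)·(11/10) = 10.01 > 10`). [folklore] -/
example : (⟨10, 1 / 100, 91 / 10⟩ : ProjectionLowerCert).check = false := by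
  have h : ¬ ((⟨10, 1 / 100, 91 / 10⟩ : ProjectionLowerCert).check = true) := by
    rw [check_eq_true_iff]; norm_num
  simpa using h

end ProjectionLowerCert

end Literature.Computation.Certificates
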